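import Mathlib
import HarnessLib
import Summits.NavierStokesRegularity.NavierStokesRegularity.Theorems.LocalSineTubeDoorLocalPointZoomCurl

/-!
# Route `LocalVelCompTubeDoor` (S10, STAGED by nsreg-p1 g9), crux K1′ `LocalPointZoomVelSlices` — support file 1:
# pointwise VELOCITY convergence of the zooms at the slice `s = −1` in the local tree zoom frame

Cell ns-regularity-ideate, seat p6 (route-directed support; lands `--supports <K1′ item>` once the route is born, or as
the director anchors it). Re-export of the velocity half of nsreg-p6 g0's interior upgrade
`…LocalSineTubeDoorLocalPointZoomCurl.localZoomFrame_curl_tendsto` (the same hypotheses — the LOCAL zoom frame of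
`…LocalPointZoomFrame.localTreeZoomFrame`): Seregin–Šverák 2009 §2 p. 8 equi-Hölder representatives
(`NSBoundedHigherRegularityBounds_holds`), `L³ → 0` + equi-Hölder ⇒ locally uniform convergence at the slice
(`…LocalPointZoomUpgrade.uniform_of_L3_of_holder`), and `Vⱼ = Zⱼ` near `(−1, y)` by continuity; the Landau/gradient
step of the curl version is simply dropped.

* `localZoomFrame_tendsto` — `Zⱼ(−1, y) → v₁(−1, y)` for every `y` (no subsequence).

WHAT THIS IS NOT: not a claim about Navier–Stokes regularity; a blow-up/compactness support lemma for a STAGED door route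
(bears_on LADDER-NS N0; nsreg-p1 ROUND-9 S10 «LocalTubeDoorVelComp»).
-/

noncomputable section

-- the summit and its single sub-problem share the name (CONVENTIONS §1), as in every Theorems file
set_option linter.dupNamespace false

namespace Summit.NavierStokesRegularity.NavierStokesRegularity.Theorems.LocalVelCompTubeDoorLocalPointZoomVel

open MeasureTheory Set Function Filter Topology TopologicalSpace Metric
open Literature.Analysis Literature.Analysis.FluidPDE Literature.Analysis.FluidPDE.SereginSverak2009
open Summit.NavierStokesRegularity.NavierStokesRegularity.Theorems
open Summit.NavierStokesRegularity.NavierStokesRegularity.Theorems.LocalSineTubeDoorProfileAlignedWindowRigidityAncient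
open Summit.NavierStokesRegularity.NavierStokesRegularity.Theorems.LocalSineTubeDoorLocalPointZoomUpgrade
open Summit.NavierStokesRegularity.NavierStokesRegularity.Theorems.LocalSineTubeDoorLocalPointZoomData
open scoped NNReal ENNReal

/-- **Pointwise velocity convergence at the slice `s = −1` in the local zoom frame** (velocity half of
`localZoomFrame_curl_tendsto`): in the zoom frame at a LOCALLY Type I point the zooms `Zⱼ = λⱼ • (v' ∘ λⱼ)` converge
to the profile `v₁` at every point `(−1, y)` (no subsequence). -/
theorem localZoomFrame_tendsto {ν T : ℝ} (hν : 0 < ν) (hT : 0 < T) {u : ℝ → (EuclideanSpace ℝ (Fin 3)) → (EuclideanSpace ℝ (Fin 3))}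
    (hcont : ContinuousOn (uncurry u) (Ico 0 T ×ˢ univ)) {x₀ : (EuclideanSpace ℝ (Fin 3))} {ρ M : ℝ} (hρ : 0 < ρ)
    (hM : ∀ t ∈ Ico 0 T, T - ρ ^ 2 < t → ∀ x ∈ ball x₀ ρ, ‖u t x‖ * Real.sqrt (ν * (T - t)) ≤ M)
    {R : ℝ} (hR : 0 < R) {v' : ℝ → (EuclideanSpace ℝ (Fin 3)) → (EuclideanSpace ℝ (Fin 3))} {π' : ℝ → (EuclideanSpace ℝ (Fin 3)) → ℝ}
    (hball1 : IsSuitableWeakSolutionInBall 1 0 v' π') {lam : ℕ → ℝ} (hlam : ∀ j, 0 < lam j)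
    (hlam0 : Tendsto lam atTop (𝓝 0)) {Ks : ℝ≥0} {r₁ : ℝ} (hr₁ : 0 < r₁) (hr₁1 : r₁ ≤ 1)
    (hKs : ∀ r ∈ Ioc (0 : ℝ) r₁, cknD r (0 : ℝ × (EuclideanSpace ℝ (Fin 3))) π' ≤ Ks)
    (hpt : ∀ (j : ℕ) (s : ℝ) (y : (EuclideanSpace ℝ (Fin 3))), ((lam j) • stPull ((lam j) ^ 2) (lam j) (0 : ℝ) (0 : (EuclideanSpace ℝ (Fin 3))) v') s y =
      ((R * (lam j / 2)) / ν) • u (T + (R * (lam j / 2)) ^ 2 * s / ν) (x₀ + (R * (lam j / 2)) • y))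
    {w v₁ : ℝ → (EuclideanSpace ℝ (Fin 3)) → (EuclideanSpace ℝ (Fin 3))}
    (hL3 : ∀ a : ℝ, 0 < a → Tendsto (fun j => eLpNorm (uncurry ((lam j) • stPull ((lam j) ^ 2) (lam j) (0 : ℝ) (0 : (EuclideanSpace ℝ (Fin 3))) v') - uncurry w) 3
      (volume.restrict (parabolicCylinder a (0 : ℝ × (EuclideanSpace ℝ (Fin 3)))))) atTop (𝓝 0))
    (hae : ∀ᵐ x ∂(volume.restrict (Iio (0 : ℝ) ×ˢ (univ : Set (EuclideanSpace ℝ (Fin 3))))), uncurry w x = uncurry v₁ x)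
    (hv₁cont : ContinuousOn (uncurry v₁) (Iio (0 : ℝ) ×ˢ univ)) (y : (EuclideanSpace ℝ (Fin 3))) :
    Tendsto (fun j => ((lam j) • stPull ((lam j) ^ 2) (lam j) (0 : ℝ) (0 : (EuclideanSpace ℝ (Fin 3))) v') (-1) y) atTop (𝓝 (v₁ (-1) y)) := by
  obtain ⟨J, hJ⟩ := localZoomFrame_data hν hT hρ hM hR hball1 hlam hlam0 hr₁ hr₁1 hKs hpt y
  have hΛpos : ∀ j, 0 < (R * (lam j / 2)) := fun j => mul_pos hR (half_pos (hlam j))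
  have hZpt : ∀ (j : ℕ) (s : ℝ) (y' : (EuclideanSpace ℝ (Fin 3))),
      ((lam j) • stPull ((lam j) ^ 2) (lam j) (0 : ℝ) (0 : (EuclideanSpace ℝ (Fin 3))) v') s y' = ((R * (lam j / 2)) / ν) • u (T + (R * (lam j / 2)) ^ 2 * s / ν) (x₀ + (R * (lam j / 2)) • y') :=
    hpt
  set a : ℝ := ‖y‖ + 2 with ha_def
  have ha : 0 < a := by positivity
  have hmemQ : ∀ {r : ℝ} {w : ℝ × (EuclideanSpace ℝ (Fin 3))},
      w ∈ parabolicCylinder r ((-(1 / 2) : ℝ), y) ↔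
        (-(1 / 2) - r ^ 2 < w.1 ∧ w.1 < -(1 / 2)) ∧ dist w.2 y < r := by
    intro r w
    simp only [parabolicCylinder, mem_prod, mem_Ioo, mem_ball]
  have htime : ∀ j, J ≤ j → ∀ s : ℝ, -(3 / 2) < s → s < -(1 / 2) →
      T + (R * (lam j / 2)) ^ 2 * s / ν ∈ Ico 0 T := by
    intro j hj s hs1 hs2
    have hC := (hJ j hj).1
    have hΛ2 : 0 < (R * (lam j / 2)) ^ 2 := pow_pos (hΛpos j) 2
    refine ⟨?_, ?_⟩
    · have key : 0 ≤ ν * T + (R * (lam j / 2)) ^ 2 * s := by nlinarith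
      have e : T + (R * (lam j / 2)) ^ 2 * s / ν = (ν * T + (R * (lam j / 2)) ^ 2 * s) / ν := by
        field_simp
      rw [e]
      exact div_nonneg key hν.le
    · have : (R * (lam j / 2)) ^ 2 * s / ν < 0 := div_neg_of_neg_of_pos (by nlinarith) hν
      linarith
  -- ## Seregin–Šverák §2 p. 8: equi-Hölder smooth representatives with uniform bounds
  obtain ⟨Kr, Cr, αr, hαr, hreg⟩ := NSBoundedHigherRegularityBounds_holds (1 : ℝ)
    (M * Real.sqrt 2 / ν) (((‖y‖ + 2) ^ 2).toNNReal * Ks)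
  have hch : ∀ j, ∃ V : ℝ → (EuclideanSpace ℝ (Fin 3)) → (EuclideanSpace ℝ (Fin 3)), J ≤ j →
      (uncurry ((lam j) • stPull ((lam j) ^ 2) (lam j) (0 : ℝ) (0 : (EuclideanSpace ℝ (Fin 3))) v') =ᵐ[volume.restrict (parabolicCylinder 1 ((-(1 / 2) : ℝ), y))] uncurry V) ∧
      (∀ w ∈ parabolicCylinder 1 ((-(1 / 2) : ℝ), y), ContDiffAt ℝ (⊤ : ℕ∞) (V w.1) w.2) ∧
      ∀ n : ℕ, ∀ r ∈ Ioo (0 : ℝ) 1,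
        HolderOnWith (Cr n r) (αr n r) (fun w : ℝ × (EuclideanSpace ℝ (Fin 3)) => iteratedFDeriv ℝ n (V w.1) w.2)
          (parabolicCylinder r ((-(1 / 2) : ℝ), y)) ∧
        ∀ w ∈ parabolicCylinder r ((-(1 / 2) : ℝ), y), ‖iteratedFDeriv ℝ n (V w.1) w.2‖ ≤ Kr n r := by
    intro j
    by_cases hj : J ≤ j
    · obtain ⟨V, hV⟩ := hreg ((lam j) • stPull ((lam j) ^ 2) (lam j) (0 : ℝ) (0 : (EuclideanSpace ℝ (Fin 3))) v') ((lam j) ^ 2 • stPull ((lam j) ^ 2) (lam j) (0 : ℝ) (0 : (EuclideanSpace ℝ (Fin 3))) π') ((-(1 / 2) : ℝ), y) (hJ j hj).2.1 (hJ j hj).2.2.1 (hJ j hj).2.2.2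
      exact ⟨V, fun _ => hV⟩
    · exact ⟨fun _ _ => 0, fun h => absurd h hj⟩
  choose V hV using hch
  -- ## cylinders about the slice `s = -1`
  have h78 : (7 / 8 : ℝ) ∈ Ioo (0 : ℝ) 1 := ⟨by norm_num, by norm_num⟩
  have hQ71 : parabolicCylinder (7 / 8) ((-(1 / 2) : ℝ), y) ⊆
      parabolicCylinder 1 ((-(1 / 2) : ℝ), y) := by
    intro w hw
    rw [hmemQ] at hw ⊢
    obtain ⟨⟨h1, h2⟩, h3⟩ := hw
    exact ⟨⟨by linarith, h2⟩, by linarith⟩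
  have hQ7a : parabolicCylinder (7 / 8) ((-(1 / 2) : ℝ), y) ⊆ parabolicCylinder a (0 : ℝ × (EuclideanSpace ℝ (Fin 3))) := by
    intro w hw
    rw [hmemQ] at hw
    obtain ⟨⟨h1, h2⟩, h3⟩ := hw
    have ha2 : 2 ≤ a := by rw [ha_def]; linarith [norm_nonneg y]
    have ha4 : 4 ≤ a ^ 2 := by nlinarith
    simp only [parabolicCylinder, mem_prod, mem_Ioo, mem_ball, Prod.fst_zero, Prod.snd_zero,
      zero_sub, dist_zero_right]
    refine ⟨⟨by linarith, by linarith⟩, ?_⟩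
    calc ‖w.2‖ ≤ dist w.2 y + ‖y‖ := by simpa [dist_zero_right] using dist_triangle w.2 y 0
      _ < a := by rw [ha_def]; linarith
  have hQ7slab : parabolicCylinder (7 / 8) ((-(1 / 2) : ℝ), y) ⊆ Iio (0 : ℝ) ×ˢ univ := by
    intro w hw
    rw [hmemQ] at hw
    exact mem_prod.2 ⟨by simpa using (by linarith [hw.1.2] : w.1 < 0), mem_univ _⟩
  have hmem1 : ∀ y' ∈ ball y (1 / 4), ((-1 : ℝ), y') ∈ parabolicCylinder 1 ((-(1 / 2) : ℝ), y) := by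
    intro y' hy'
    rw [hmemQ]
    exact ⟨⟨by norm_num, by norm_num⟩, by linarith [mem_ball.1 hy']⟩
  have hmem7 : ∀ y' ∈ ball y (7 / 8),
      ((-1 : ℝ), y') ∈ parabolicCylinder (7 / 8) ((-(1 / 2) : ℝ), y) := by
    intro y' hy'
    rw [hmemQ]
    exact ⟨⟨by norm_num, by norm_num⟩, mem_ball.1 hy'⟩
  -- ## `V j = zoom` on `Q(z, 7/8)` (both continuous), hence equal gradients at `(-1, y)`
  have hZcont : ∀ j, J ≤ j → ContinuousOn (uncurry ((lam j) • stPull ((lam j) ^ 2) (lam j) (0 : ℝ) (0 : (EuclideanSpace ℝ (Fin 3))) v')) (parabolicCylinder 1 ((-(1 / 2) : ℝ), y)) := by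
    intro j hj
    have hφ : Continuous fun w : ℝ × (EuclideanSpace ℝ (Fin 3)) => (T + (R * (lam j / 2)) ^ 2 * w.1 / ν, x₀ + (R * (lam j / 2)) • w.2) := by
      fun_prop
    have hmaps : MapsTo (fun w : ℝ × (EuclideanSpace ℝ (Fin 3)) => (T + (R * (lam j / 2)) ^ 2 * w.1 / ν, x₀ + (R * (lam j / 2)) • w.2))
        (parabolicCylinder 1 ((-(1 / 2) : ℝ), y)) (Ico 0 T ×ˢ univ) := by
      intro w hw
      rw [hmemQ] at hw
      exact mem_prod.2 ⟨htime j hj w.1 (by linarith [hw.1.1]) hw.1.2, mem_univ _⟩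
    have hc := (hcont.comp hφ.continuousOn hmaps).const_smul ((R * (lam j / 2)) / ν)
    refine hc.congr fun w _ => ?_
    exact hZpt j w.1 w.2
  have hVH : ∀ j, J ≤ j → HolderOnWith (Cr 0 (7 / 8)) (αr 0 (7 / 8))
      (fun w : ℝ × (EuclideanSpace ℝ (Fin 3)) => V j w.1 w.2) (parabolicCylinder (7 / 8) ((-(1 / 2) : ℝ), y)) := by
    intro j hj w hw w' hw'
    have h := ((hV j hj).2.2 0 (7 / 8) h78).1 w hw w' hw'
    simpa only [iteratedFDeriv_zero_eq_comp, Function.comp_apply, LinearIsometryEquiv.edist_map]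
      using h
  have hVcont : ∀ j, J ≤ j → ContinuousOn (uncurry (V j))
      (parabolicCylinder (7 / 8) ((-(1 / 2) : ℝ), y)) := fun j hj =>
    ((hVH j hj).uniformContinuousOn (hαr 0 (7 / 8) h78)).continuousOn
  have hEqOn : ∀ j, J ≤ j → EqOn (uncurry ((lam j) • stPull ((lam j) ^ 2) (lam j) (0 : ℝ) (0 : (EuclideanSpace ℝ (Fin 3))) v')) (uncurry (V j))
      (parabolicCylinder (7 / 8) ((-(1 / 2) : ℝ), y)) := fun j hj =>
    Measure.eqOn_open_of_ae_eq (ae_restrict_of_ae_restrict_of_subset hQ71 (hV j hj).1)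
      (isOpen_parabolicCylinder _ _) ((hZcont j hj).mono hQ71) (hVcont j hj)
  -- ## level zero: `V j (-1, ·) → v₁ (-1, ·)` uniformly on `ball y (1/4)`
  have hHol : ∀ᶠ j in atTop, HolderOnWith (Cr 0 (7 / 8)) (αr 0 (7 / 8))
      (fun w : ℝ × (EuclideanSpace ℝ (Fin 3)) => V j w.1 w.2) (parabolicCylinder (7 / 8) ((-(1 / 2) : ℝ), y)) := by
    filter_upwards [eventually_ge_atTop J] with j hj
    exact hVH j hj
  have hUC : UniformContinuousOn (fun w : ℝ × (EuclideanSpace ℝ (Fin 3)) => v₁ w.1 w.2)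
      (parabolicCylinder (7 / 8) ((-(1 / 2) : ℝ), y)) := by
    have hKc : IsCompact (Icc (-2 : ℝ) (-(1 / 4)) ×ˢ closedBall y 1) :=
      isCompact_Icc.prod (isCompact_closedBall y 1)
    have hKslab : Icc (-2 : ℝ) (-(1 / 4)) ×ˢ closedBall y 1 ⊆ Iio (0 : ℝ) ×ˢ univ := by
      intro w hw
      have h := (mem_Icc.1 (mem_prod.1 hw).1).2
      exact mem_prod.2 ⟨by simpa using (by linarith : w.1 < 0), mem_univ _⟩
    have hQK : parabolicCylinder (7 / 8) ((-(1 / 2) : ℝ), y) ⊆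
        Icc (-2 : ℝ) (-(1 / 4)) ×ˢ closedBall y 1 := by
      intro w hw
      rw [hmemQ] at hw
      obtain ⟨⟨h1, h2⟩, h3⟩ := hw
      exact mem_prod.2 ⟨⟨by linarith, by linarith⟩, mem_closedBall.2 (by linarith)⟩
    exact (hKc.uniformContinuousOn_of_continuous (hv₁cont.mono hKslab)).mono hQK
  have hL3' : Tendsto (fun j => eLpNorm (fun w : ℝ × (EuclideanSpace ℝ (Fin 3)) => V j w.1 w.2 - v₁ w.1 w.2) 3
      (volume.restrict (parabolicCylinder (7 / 8) ((-(1 / 2) : ℝ), y)))) atTop (𝓝 0) := by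
    have h3 := hL3 a ha
    refine tendsto_of_tendsto_of_tendsto_of_le_of_le' tendsto_const_nhds h3
      (Eventually.of_forall fun _ => zero_le) ?_
    filter_upwards [eventually_ge_atTop J] with j hj
    have hae1 : ∀ᵐ x ∂(volume.restrict (parabolicCylinder (7 / 8) ((-(1 / 2) : ℝ), y))),
        uncurry ((lam j) • stPull ((lam j) ^ 2) (lam j) (0 : ℝ) (0 : (EuclideanSpace ℝ (Fin 3))) v') x = uncurry (V j) x := ae_restrict_of_ae_restrict_of_subset hQ71 (hV j hj).1
    have hae2 : ∀ᵐ x ∂(volume.restrict (parabolicCylinder (7 / 8) ((-(1 / 2) : ℝ), y))),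
        uncurry w x = uncurry v₁ x := ae_restrict_of_ae_restrict_of_subset hQ7slab hae
    calc eLpNorm (fun w : ℝ × (EuclideanSpace ℝ (Fin 3)) => V j w.1 w.2 - v₁ w.1 w.2) 3
          (volume.restrict (parabolicCylinder (7 / 8) ((-(1 / 2) : ℝ), y)))
        = eLpNorm (uncurry ((lam j) • stPull ((lam j) ^ 2) (lam j) (0 : ℝ) (0 : (EuclideanSpace ℝ (Fin 3))) v') - uncurry w) 3
          (volume.restrict (parabolicCylinder (7 / 8) ((-(1 / 2) : ℝ), y))) := by
          refine eLpNorm_congr_ae ?_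
          filter_upwards [hae1, hae2] with x hx1 hx2
          rw [Pi.sub_apply, hx1, hx2]
          rfl
      _ ≤ eLpNorm (uncurry ((lam j) • stPull ((lam j) ^ 2) (lam j) (0 : ℝ) (0 : (EuclideanSpace ℝ (Fin 3))) v') - uncurry w) 3
          (volume.restrict (parabolicCylinder a (0 : ℝ × (EuclideanSpace ℝ (Fin 3))))) :=
          eLpNorm_mono_measure _ (Measure.restrict_mono hQ7a le_rfl)
  have hS : ∀ w ∈ {w : ℝ × (EuclideanSpace ℝ (Fin 3)) | w.1 = -1 ∧ w.2 ∈ ball y (1 / 4)},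
      ball w (1 / 4) ⊆ parabolicCylinder (7 / 8) ((-(1 / 2) : ℝ), y) := by
    rintro w ⟨hw1, hw2⟩ w' hw'
    rw [hmemQ]
    have hd := mem_ball.1 hw'
    rw [Prod.dist_eq, max_lt_iff] at hd
    obtain ⟨hd1, hd2⟩ := hd
    rw [hw1, Real.dist_eq] at hd1
    have hd1' := abs_lt.1 hd1
    refine ⟨⟨by linarith, by linarith⟩, ?_⟩
    calc dist w'.2 y ≤ dist w'.2 w.2 + dist w.2 y := dist_triangle _ _ _
      _ < 1 / 4 + 1 / 4 := add_lt_add hd2 (mem_ball.1 hw2)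
      _ < 7 / 8 := by norm_num
  have hU := uniform_of_L3_of_holder (isOpen_parabolicCylinder _ _) (hαr 0 (7 / 8) h78) hHol hUC
    hL3' (by norm_num : (0 : ℝ) < 1 / 4) hS
  -- ## conclusion: `V j (-1, y) = zoom (-1, y)` and the uniform convergence at the point
  refine Metric.tendsto_atTop.2 fun ε hε => ?_
  obtain ⟨N, hN⟩ := eventually_atTop.1 ((hU ε hε).and (eventually_ge_atTop J))
  refine ⟨N, fun j hj => ?_⟩
  obtain ⟨hUj, hJj⟩ := hN j hj
  have hyS : ((-1 : ℝ), y) ∈ {w : ℝ × (EuclideanSpace ℝ (Fin 3)) | w.1 = -1 ∧ w.2 ∈ ball y (1 / 4)} :=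
    ⟨rfl, mem_ball_self (by norm_num)⟩
  have hVy := hUj ((-1 : ℝ), y) hyS
  have hEq : ((lam j) • stPull ((lam j) ^ 2) (lam j) (0 : ℝ) (0 : (EuclideanSpace ℝ (Fin 3))) v') (-1) y = V j (-1) y :=
    hEqOn j hJj (hmem7 y (mem_ball_self (by norm_num)))
  rw [dist_eq_norm, hEq]
  exact hVy

end Summit.NavierStokesRegularity.NavierStokesRegularity.Theorems.LocalVelCompTubeDoorLocalPointZoomVel

end
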